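import Summits.ABC.IUTFork.Conditional.WRowLicenceTripleSocketM
import Summits.ABC.IUTFork.Cor312LicenceWildInhabitedGenuineK
import Summits.ABC.IUTFork.Cor312ProvKChosenQIdeleNorm
import HarnessLib

/-!
# Branch C / R-W, reading (U), M line: the M-LEVEL LICENCE FROM THE K-SIDE PER-PRIME PACKAGES — a TRANSFER SOCKET whose hypotheses are
# VERBATIM those of abc-iut-w4-d036's K orders socket `Cor312Prov.licence_settingPrVolSharp_pilotDataOfK_of_orders_rat`
# (abc-iut cell, branch C, row «C:INH-M-TWIN-RESIDUE»; seat abc-iut-C-cert-2 gen 8; C LEAD KEY 2026-08-27T13:11Z)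

Record-only PROOF file (D-0012; 0 definitions, 0 `Prop` facts, nothing re-typed) of the abc-iut cell. TAKES NO SIDE on [IUTchIII] Cor. 3.12
(S. Mochizuki, *Inter-universal Teichmüller theory III*, Cor. 3.12 p. 173–174; Step (xi-f) p. 184) or on any author; «inhabited as typed» ≠
«asserted in print».

WHY. The R-W lane's kernel INHABITED theorems that are NOT one socket-apply away from an M twin (abc-iut-rw-num-lead's
`plan/rescue/R-W/M-TWIN-GAP-INH.tsv`: the `InhUniformBand<Frey>` uniform bands of the small Frey points and of the `67`-triple
`2^5·67^8·107·22381 + 5^4·53^6·353^5 = 3^22·7^14·43·83`, the `WRowFrey283Unconditional<L>` / `WRowFrey301327048Unconditional` /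
`WRowFrey343Inhabited` levels) are HAND-BUILT: each proves `Thm311ToCor312.Licence (settingPrVolSharp (pilotDataOfK T.D T.K) …)` by feeding
abc-iut-w4-d036's K orders socket `Cor312Prov.licence_settingPrVolSharp_pilotDataOfK_of_orders_rat` per-prime integers `(e, D, h, ρin, ρout)`
together with (i) a LOCAL PACKAGE at every bad K-fibre point `x ∣ p` — `e(K_x/ℚ_p) = e_p`, `D_p/e_p ≤ d(K_x)`, a NON-member of
`log_p(𝒪^×_{K_x})` of norm `≤ p^{−(ρin_p−1)/e_p}`, a MEMBER of norm `≥ p^{−ρout_p/e_p}`, `ord_p j = −h_p`, `2l ∣ e_p·h_p` — and (ii) the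
integer CELLS at every label. THIS FILE proves that THE SAME TWO HYPOTHESIS FUNCTIONS (letter for letter the K socket's `hloc` and `hcell`;
its third hypothesis `hiso` is not needed) already give the licence at the M-LEVEL setting of the datum's own ideles
`settingPrVolSharpM D hlog (tOfIdeleData D r) (tqM … r …) …` for EVERY idele datum `r`: a member `x ∈ V̲_u` of a bad rational place `u` lies
on the place `placeOfM x = placeOf x'` of a bad K-fibre point `x'` (`fibreEquivPlacesOver`, `mem_pilotDataOfK_S_iff`); the local fields
`kOf … x'` and `kOfM … x` are THE SAME rescaled completion of `K` at that place (so the index, the different and BOTH shell witnesses move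
across by `absRamificationIdx_rescaledCompletion` / `differentOrd_rescaledCompletion` / substitution along `placeOf x' = placeOfM x`); the
q-idele norm `‖t_{q,x}‖ = p^{ord_p(j)/(2l)}` (abc-iut-C-cert-2 gen 3's `norm_tqM_eq_rpow_ord_rat`) reads `p^{−P/e}` with `P = e·h/(2l)` off
`ord_p j = −h` (the places of `ℚ` below `placeModOfM x` and below `placeOf x'` coincide: both lie over `p`, `natGenerator_injective`); and the
cells are the K cells at the label `i` (`l⋆ = (l−1)/2` on both index skeletons). Then abc-iut-C-cert-2 gen 7's M orders socket
`WRowM.licence_tOfIdeleData_of_orders_rat` (file A, `WRowLicenceSocketM`) concludes.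

* **`WRowM.licence_tOfIdeleData_of_ordersK_rat`** — hypotheses `(j₀, hj, e, Dd, h, ρin, ρout, hloc, hcell)` VERBATIM the K socket's ⟹
  `Thm311ToCor312.Licence (settingPrVolSharpM D hlog (tOfIdeleData D r) (tqM … r …) …)`.

CONSEQUENCE (the surgery it enables, in the consumer files): an M twin of a hand-built K theorem is its K proof with the conclusion binders
replaced by the M ones and the final `refine Cor312Prov.licence_settingPrVolSharp_pilotDataOfK_of_orders_rat …` replaced by
`refine WRowM.licence_tOfIdeleData_of_ordersK_rat …` (the `hiso` argument dropped) — every per-prime package and cell line UNCHANGED.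

HONEST SCOPE: OUR sharp containers and Dupuy–Hilado's typed (Ind1)/(Ind2); STRONGER-THAN-PRINT hull reading; a socket discharges nothing;
non-emptiness of the datum type, admissibility and Szpiro-badness NOT claimed; nothing about the printed GLOBAL inequality or the number-level
corollary; existence of initial Θ-data at any given curve is NOT claimed; typed ≠ proved; instantiated ≠ endorsed; no abc claim.
[cite: Mochizuki2012, IUTchI Def. 3.1 (b),(c),(e) pp. 61–62, Rmk. 3.1.5 p. 65, Ex. 3.2 (iv) p. 71; IUTchIII Cor. 3.12 p. 173–174, Step (xi-f)
p. 184; IUTchIV Prop. 1.1 p. 9, Prop. 1.2 (i)(ii) p. 10] [cite: DupuyHilado2025, §3.3, §3.4, §3.9, §4.9, §4.12] [cite: NeukirchANT1999, Ch. II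
(4.8), (5.5)] [claim: Mochizuki2012, status: disputed] for every IUT sentence. PROOF-ONLY: no definitions.
-/

noncomputable section

open Set Function NumberField IsDedekindDomain
open scoped Pointwise

namespace Summit.ABC.IUTFork.Conditional

open Thm311 Thm311.Real Cor312 Cor312Vol Cor312Prov Literature.IUT.LogThetaLattice Literature.IUT.LogVolume
  Literature.IUT.HodgeTheaters Literature.IUT.LogVolume.Cor22
open Literature.NumberTheory.NumberFields Literature.NumberTheory.GaloisRepresentations.Ultrametric
open Literature.NumberTheory.DiophantineGeometry Literature.NumberTheory.DiophantineGeometry.GenEll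

section Own

variable {F K Fbar : Type} [Field F] [NumberField F] [Field K] [NumberField K] [Algebra F K]
  [Field Fbar] [Algebra F Fbar] [Algebra K Fbar] {E : WeierstrassCurve F} [E.IsElliptic] {l : ℕ}
  {Pb : BadPlacePredicates K} (D : InitialThetaData F K Fbar E l Pb) {logvK : PadicLogsVal K}
  (hlog : LogvAnalyticVal logvK) (r : ThetaData.IdeleData D)
  (M : Type) [Field M] [NumberField M]
  (archPk : ∀ (j : (thetaIndexOfInitial D).Label) (vQ : (thetaIndexOfInitial D).VQ),
    Set ((logShellsOfInitialDH D logvK).Packet j vQ))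
  (archSub : ∀ (j : (thetaIndexOfInitial D).Label) (v : (thetaIndexOfInitial D).V),
    Set ((logShellsOfInitialDH D logvK).Packet j ((thetaIndexOfInitial D).over v)))
  (Ψ : ℤ → ∀ v : (thetaIndexOfInitial D).V, v ∈ (thetaIndexOfInitial D).Vbad →
    Set ((logShellsOfInitialDH D logvK).StarPacket v))
  (act : ℤ → ∀ v : (thetaIndexOfInitial D).V, v ∈ (thetaIndexOfInitial D).Vbad →
    (logShellsOfInitialDH D logvK).StarPacket v → Module.End ℚ ((logShellsOfInitialDH D logvK).StarPacket v))
  (Mmod : ℤ → ∀ j : (thetaIndexOfInitial D).LabelStar, Set ((logShellsOfInitialDH D logvK).GlobalPacket j.1))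
  (region : ℤ → ∀ j : (thetaIndexOfInitial D).LabelStar, FinDivisor M → ∀ vQ : (thetaIndexOfInitial D).VQ,
    Set ((logShellsOfInitialDH D logvK).Packet j.1 vQ))
  (n : ℤ) {HT : Type} {LogLink : HT → HT → Type} {IsFull : ∀ {s t : HT}, LogLink s t → Prop}
  (lat : LGPGaussianLogThetaLattice LogLink IsFull)
  {Frd : Type} {IsoF : Frd → Frd → Type} {Ob : Frd → Type} {realify : Frd → Frd} {Strip : Type}
  {IsoS : Strip → Strip → Type}
  {Mv : ∀ v : (thetaIndexOfInitial D).V, v ∈ (thetaIndexOfInitial D).Vbad → Type} [∀ v h, Monoid (Mv v h)]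
  (sig : GlobalLGPFrobenioidSignature (thetaIndexOfInitial D).lstar (thetaIndexOfInitial D).V
    (· ∈ (thetaIndexOfInitial D).Vbad) Frd IsoF Ob realify Strip IsoS Mv)
  (split : SplittingMonoids Mv) {ObΔ : Type}
  {N : ∀ v : (thetaIndexOfInitial D).V, v ∈ (thetaIndexOfInitial D).Vbad → Type} [∀ v h, Monoid (N v h)]
  (qData : QPilotData ObΔ N)
  (htq0 : ∀ (u : FinitePlace ℚ) (x : (thetaIndexOfInitial D).Fibre (Val.non u)),
    tqM D (ratChar u) u (natCast_ratChar_mem u) r x ≠ 0)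
  (Sq : Finset (FinitePlace ℚ))
  (htq1 : ∀ (u : FinitePlace ℚ) (x : (thetaIndexOfInitial D).Fibre (Val.non u)), u ∉ Sq →
    ‖tqM D (ratChar u) u (natCast_ratChar_mem u) r x‖ = 1)

/-- **THE (xi-f) LICENCE AT THE M-LEVEL SETTING OF THE OWN IDELES, FROM THE K-SIDE PER-PRIME PACKAGES** (rational `j`-invariant
`j = j₀ ∈ ℚ`). Hypotheses LETTER FOR LETTER those of abc-iut-w4-d036's K orders socket `Cor312Prov.licence_settingPrVolSharp_pilotDataOfK_of_orders_rat`
(minus its `hiso`): per rational prime `p` integers `e_p, D_p, h_p ∈ ℕ`, `ρin_p, ρout_p ∈ ℤ`; `hloc` — at every BAD K-fibre point `x ∣ p` of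
`X := pilotDataOfK D K`: `e(K_x/ℚ_p) = e_p`, `D_p/e_p ≤ d(K_x)`, a non-member `z ∉ log_p(𝒪^×_{K_x})` with `‖z‖ ≤ p^{−(ρin_p−1)/e_p}`, a member
`z'` with `p^{−ρout_p/e_p} ≤ ‖z'‖`, `ord_p(j₀) = −h_p` at the place of `ℚ` below `x`, and `2l ∣ e_p·h_p`; `hcell` — whenever the K-fibre over
`p` meets `X.S`, `e_p·⌊((i+1)²P_p − (i+1)D_p − (i+2)ρin_p)/e_p⌋ + (i+2)ρout_p ≤ P_p` (`P_p = e_p·h_p/(2l)`) at every label `i + 1 ≤ l⋆`. THEN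
abc-iut-c312-1's `Thm311ToCor312.Licence` HOLDS at `settingPrVolSharpM D hlog (tOfIdeleData D r) (tqM … r …) …` — for the idele datum `r`,
the analytic `logvK`, the context data and the unit-set bookkeeping `htq0/Sq/htq1` of the ambient section, all arbitrary. Proof: member ↦ bad
K-fibre point on the same place of `K`; `kOf … x'` and `kOfM … x` are the same rescaled completion; `‖t_{q,x}‖ = p^{ord_p(j₀)/(2l)} = p^{−P_p/e_p}`;
then abc-iut-C-cert-2 gen 7's M orders socket `WRowM.licence_tOfIdeleData_of_orders_rat`.
[cite: Mochizuki2012, IUTchI Def. 3.1 (b),(c),(e) pp. 61–62, Ex. 3.2 (iv) p. 71; IUTchIII Cor. 3.12 Step (xi-f) p. 184; IUTchIV Prop. 1.1 p. 9,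
Prop. 1.2 (i)(ii) p. 10] [cite: DupuyHilado2025, §3.3, §3.4, §4.9, §4.12] [cite: NeukirchANT1999, Ch. II (4.8), (5.5)] [claim: Mochizuki2012, status: disputed] -/
theorem WRowM.licence_tOfIdeleData_of_ordersK_rat (j₀ : ℚ) (hj : E.j = (j₀ : F))
    (e Dd h : Nat.Primes → ℕ) (ρin ρout : Nat.Primes → ℤ)
    (hloc : ∀ (pp : Nat.Primes) (x : (thetaIndex (pilotDataOfK D K)).Fibre (.inr pp)),
      haveI : Fact (pp : ℕ).Prime := ⟨pp.2⟩
      placeOf (pilotDataOfK D K) pp.1 x ∈ (pilotDataOfK D K).S →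
        absRamificationIdx (pp : ℕ) (kOf (pilotDataOfK D K) pp.1 x) = e pp ∧
        (Dd pp : ℝ) / (e pp : ℝ) ≤ differentOrd (pp : ℕ) (kOf (pilotDataOfK D K) pp.1 x) ∧
        (∃ z : kOf (pilotDataOfK D K) pp.1 x, z ∉ logUnits (kOf (pilotDataOfK D K) pp.1 x) ∧
          ‖z‖ ≤ ((pp : ℕ) : ℝ) ^ (-(((ρin pp : ℝ) - 1) / (e pp : ℝ)))) ∧
        (∃ z ∈ logUnits (kOf (pilotDataOfK D K) pp.1 x), ((pp : ℕ) : ℝ) ^ (-((ρout pp : ℝ) / (e pp : ℝ))) ≤ ‖z‖) ∧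
        ord ℚ (Literature.IUT.LogVolume.finBelow ℚ K (placeOf (pilotDataOfK D K) pp.1 x)) j₀ = -(h pp : ℤ) ∧ 2 * l ∣ e pp * h pp)
    (hcell : ∀ (pp : Nat.Primes), (haveI : Fact (pp : ℕ).Prime := ⟨pp.2⟩
        ∃ x : (thetaIndex (pilotDataOfK D K)).Fibre (.inr pp), placeOf (pilotDataOfK D K) pp.1 x ∈ (pilotDataOfK D K).S) →
      ∀ i : Fin (pilotDataOfK D K).lstar,
        (e pp : ℤ) * (((((i : ℕ) + 1 : ℕ) : ℤ) ^ 2 * ((e pp * h pp / (2 * l) : ℕ) : ℤ) - (((i : ℕ) + 1 : ℕ) : ℤ) * (Dd pp : ℤ) -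
            (((i : ℕ) + 2 : ℕ) : ℤ) * ρin pp) / (e pp : ℤ)) + (((i : ℕ) + 2 : ℕ) : ℤ) * ρout pp ≤ ((e pp * h pp / (2 * l) : ℕ) : ℤ)) :
    Thm311ToCor312.Licence
      (settingPrVolSharpM D hlog (tOfIdeleData D r) (fun u x => tqM D (ratChar u) u (natCast_ratChar_mem u) r x) M archPk archSub
        Ψ act Mmod region n lat sig split qData htq0 Sq htq1) := by
  classical
  have hjr : E.j ∈ Set.range (algebraMap ℚ F) := ⟨j₀, by rw [hj, eq_ratCast]⟩
  have hlstarK : (pilotDataOfK D K).lstar = (l - 1) / 2 := by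
    show ((pilotDataOfK D K).l - 1) / 2 = (l - 1) / 2
    rw [pilotDataOfK_l]
  have hlstarM : (thetaIndexOfInitial D).lstar = (l - 1) / 2 := by
    show ((ThetaData.pilotData D).l - 1) / 2 = (l - 1) / 2
    rw [ThetaData.pilotData_l]
  -- the K-fibre point on the place of a member, and badness transported to the K datum
  set X := pilotDataOfK D K with hX
  have hKpt : ∀ (u : FinitePlace ℚ) (x : (thetaIndexOfInitial D).Fibre (Val.non u)),
      ∃ x' : (thetaIndex X).Fibre (.inr ⟨ratChar u, Fact.out⟩),
        placeOf X (ratChar u) x' = placeOfM D u x := by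
    intro u x
    refine ⟨(fibreEquivPlacesOver X ⟨ratChar u, Fact.out⟩).symm
      ⟨placeOfM D u x, placeOfM_mem_placesOver D (ratChar u) u (natCast_ratChar_mem u) x⟩, ?_⟩
    show (fibreEquivPlacesOver X ⟨ratChar u, Fact.out⟩ ((fibreEquivPlacesOver X ⟨ratChar u, Fact.out⟩).symm _)).1 = _
    rw [Equiv.apply_symm_apply]
  have hbadK : ∀ (u : FinitePlace ℚ) (x : (thetaIndexOfInitial D).Fibre (Val.non u)),
      placeModOfM D u x ∈ (ThetaData.pilotData D).S → placeOfM D u x ∈ X.S := by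
    intro u x hx
    rw [hX, mem_pilotDataOfK_S_iff, ThetaData.mk_mem_VFbad_iff]
    rw [ThetaData.pilotData_S] at hx
    exact hx
  -- `kOf X p x'` and `kOfM D p u x` are the SAME rescaled completion of `K` once `placeOf x' = placeOfM x`: the shell witnesses move across
  have hin_tr : ∀ (p : ℕ) [Fact p.Prime] {v w : HeightOneSpectrum (𝓞 K)} (_ : v = w)
      (hv : ((p : ℕ) : 𝓞 K) ∈ v.asIdeal) (hw : ((p : ℕ) : 𝓞 K) ∈ w.asIdeal) (ρ s : ℝ),
      (∃ z : RescaledCompletion K p v hv, z ∉ logUnits (RescaledCompletion K p v hv) ∧ ‖z‖ ≤ (p : ℝ) ^ (-((ρ - 1) / s))) →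
        ∃ z : RescaledCompletion K p w hw, z ∉ logUnits (RescaledCompletion K p w hw) ∧ ‖z‖ ≤ (p : ℝ) ^ (-((ρ - 1) / s)) := by
    intro p _ v w hvw
    subst hvw
    intro hv hw ρ s hz
    exact hz
  have hout_tr : ∀ (p : ℕ) [Fact p.Prime] {v w : HeightOneSpectrum (𝓞 K)} (_ : v = w)
      (hv : ((p : ℕ) : 𝓞 K) ∈ v.asIdeal) (hw : ((p : ℕ) : 𝓞 K) ∈ w.asIdeal) (ρ s : ℝ),
      (∃ z ∈ logUnits (RescaledCompletion K p v hv), (p : ℝ) ^ (-(ρ / s)) ≤ ‖z‖) →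
        ∃ z ∈ logUnits (RescaledCompletion K p w hw), (p : ℝ) ^ (-(ρ / s)) ≤ ‖z‖ := by
    intro p _ v w hvw
    subst hvw
    intro hv hw ρ s hz
    exact hz
  refine WRowM.licence_tOfIdeleData_of_orders_rat D hlog r M archPk archSub Ψ act Mmod region n lat sig split qData htq0 Sq htq1 hjr
    (fun u => e ⟨ratChar u, Fact.out⟩) (fun u => Dd ⟨ratChar u, Fact.out⟩)
    (fun u => e ⟨ratChar u, Fact.out⟩ * h ⟨ratChar u, Fact.out⟩ / (2 * l))
    (fun u => ρin ⟨ratChar u, Fact.out⟩) (fun u => ρout ⟨ratChar u, Fact.out⟩) (fun u x hx => ?_) (fun u hu i => ?_)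
  · -- the local package at a bad member: the K package at the K-fibre point on the same place
    set pp : Nat.Primes := ⟨ratChar u, Fact.out⟩ with hpp
    obtain ⟨x', hx'⟩ := hKpt u x
    have hxS : placeOf X pp.1 x' ∈ X.S := by rw [hx']; exact hbadK u x hx
    obtain ⟨he, hD, hin, hout, hord, hdvd⟩ := hloc pp x' hxS
    have heK : absRamificationIdx (pp : ℕ) (kOf X pp.1 x') =
        absRamificationIdx (ratChar u) (kOfM D (ratChar u) u (natCast_ratChar_mem u) x) := by
      show absRamificationIdx (ratChar u) (kOf X (ratChar u) x') = _
      rw [absRamificationIdx_rescaledCompletion, absRamificationIdx_rescaledCompletion, hx']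
    have hdK : differentOrd (pp : ℕ) (kOf X pp.1 x') = differentOrd (ratChar u) (kOfM D (ratChar u) u (natCast_ratChar_mem u) x) := by
      show differentOrd (ratChar u) (kOf X (ratChar u) x') = _
      rw [differentOrd_rescaledCompletion, differentOrd_rescaledCompletion, hx']
    have he0 : 0 < e pp := by rw [← he]; exact absRamificationIdx_pos _ _
    refine ⟨?_, ?_, ?_, ?_, ?_⟩
    · rw [← heK]; exact he
    · rw [← hdK]; exact hD
    · exact hin_tr (ratChar u) hx' (natCast_mem_placeOf X (ratChar u) x') (natCast_mem_placeOfM D (ratChar u) u (natCast_ratChar_mem u) x)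
        _ _ hin
    · exact hout_tr (ratChar u) hx' (natCast_mem_placeOf X (ratChar u) x') (natCast_mem_placeOfM D (ratChar u) u (natCast_ratChar_mem u) x)
        _ _ hout
    · -- `‖t_{q,x}‖ = p^{ord_p(j₀)/(2l)} = p^{−P/e}`, `P = e·h/(2l)`
      rw [norm_tqM_eq_rpow_ord_rat D (ratChar u) u (natCast_ratChar_mem u) r x hx j₀ hj]
      have hv : Literature.IUT.LogVolume.finBelow ℚ (fieldOfModuli E) (placeModOfM D u x) =
          Literature.IUT.LogVolume.finBelow ℚ K (placeOf X pp.1 x') :=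
        UniformABCConjecture.natGenerator_injective
          ((natGenerator_finBelow_placeModOfM D (ratChar u) u (natCast_ratChar_mem u) x).trans
            (natGenerator_finBelow_placeOf D pp x').symm)
      rw [hv, hord]
      congr 1
      have hl0 : (0 : ℝ) < (l : ℝ) := by exact_mod_cast lt_of_lt_of_le (by norm_num) D.five_le_l
      have he0' : (0 : ℝ) < (e pp : ℝ) := by exact_mod_cast he0
      have h2l : ((2 * l : ℕ) : ℝ) ≠ 0 := by push_cast; positivity
      rw [Nat.cast_div hdvd h2l]
      push_cast
      field_simp
  · -- the integer cells at every label `i + 1 ≤ l⋆`: the K cells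
    obtain ⟨x, hx⟩ := hu
    set pp : Nat.Primes := ⟨ratChar u, Fact.out⟩ with hpp
    obtain ⟨x', hx'⟩ := hKpt u x
    have hxS : placeOf X pp.1 x' ∈ X.S := by rw [hx']; exact hbadK u x hx
    have hi : (i : ℕ) < (pilotDataOfK D K).lstar := by rw [hlstarK, ← hlstarM]; exact i.isLt
    exact hcell pp ⟨x', hxS⟩ ⟨i, hi⟩

end Own

end Summit.ABC.IUTFork.Conditional

end
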